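import Mathlib
import Summits.KontsevichZagierPeriods.Zeta5Search.Profile13cCellsA
import Summits.KontsevichZagierPeriods.Zeta5Search.Profile13cCellsB
import Summits.KontsevichZagierPeriods.Zeta5Search.Profile13dCellsA
import Summits.KontsevichZagierPeriods.Zeta5Search.Profile13dCellsB
import Summits.KontsevichZagierPeriods.Zeta5Search.DenomLaw.Profile15aPath
import Summits.KontsevichZagierPeriods.Zeta5Search.DenomLaw.ZeroPointCoverKit
import Summits.KontsevichZagierPeriods.Zeta5Search.DenomLaw.ZeroCoverKit
import Summits.KontsevichZagierPeriods.Zeta5Search.DenomLaw.LawA3KCoverKit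
import Summits.KontsevichZagierPeriods.Zeta5Search.FlagRayDominance
import Summits.KontsevichZagierPeriods.Zeta5Search.TopFamilyFPCasLB
import HarnessLib

/-!
# ζ(5) search — the `N_p = 13` PROFILES 14c AND 14d of the first period for EVERY sorted parameter vector: PATH accounting at every depth (DENOM-LAW D1, prover-d1 gen 22)

Cell `pub-zeta5` (HONEST FRAMING: systematic search; no irrationality claim unless certified), TRACK «DENOM-LAW» D1 prover seat (denom-prover-d1
gen 22, `HOME/denom-law/prover-d1/ATTEMPT-22.md` §6).  The four a = 7 profiles with exactly eight short pair blocks: short `(1,2),…,(1,5),(2,3),(2,4),(2,5),(3,4)`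
(13a), `(1,2),…,(1,6),(2,3),(2,4),(3,4)` (13b), `(1,2),…,(1,7),(2,3),(2,4)` (13c), `(1,2),…,(1,6),(2,3),(2,4),(2,5)` (13d).  On each `p < d < 3p` and
`N_p = 13`; `C⋆ ≤ 11` (13a, 13b, 13d) resp. `C⋆ ≤ 10` (13c: no long block through parameter 1, gen 18's `cStar_le_ten_15a`), so the node asks `−6 / −5` resp.
`−7 / −6` at `⌊d/p⌋ = 1 / 2`.  The machine-generated covers `FullProfile.cover13x_ev/od` (`Profile13{a,b,c,d}Cells{A,B}`, gen 17/18's generator with four new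
constraint sets; every leaf lemma reused from landed profiles) pass the spelled-out checks of LANDED kits (`decide`): at `⌊d/p⌋ = 1` the LEMMA-D bonus with LB
fallback (`TopFamFP.cover_J_j`, `m = −5`; 13a deep pair `[1,−6,−1,1]`, 13b `[1,−5,−2,1]`), the DOUBLE DROP with LB fallback (`StairFLAG.cover_B_j`, `N = 6`; 13c) or
THEOREM A‴ in 𝒦-form (`DenomLaw.cover_A3K` at `(6, [1,−4,−4,1])`; 13d); at `⌊d/p⌋ = 2` the ZERO-POINT law at `M = 6` (`DenomLaw.zeroPointBound_of_classes`; 13a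
`(6; [], [[1,−6,−1,1]])`, 13b `(6; [], [[1,−5,−2,1]])`, 13d `(6; [[1,−4,−4,1]], [])`) or the ZERO law (`DenomLaw.zeroBound_of_classes`; 13c
`(6; [[1,−4,−4,1]], [[1,−5,−2,1]])`).  Results: `pathAccounting_profile13x` (every `j`) and **`pathAccountingFirstPeriod_profile13x`** (the node's binders
VERBATIM plus `p ≤ b₇` and the profile inequalities; no depth hypothesis), x ∈ {c, d}.  Census beside the proof (gen 22, exhaustive a = 7 at p = 7, 11,
30 % sample at p = 13): 13a 3,052 instances · 13b 2,605 · 13c 1,976 · 13d 1,420, every one reached by exactly these rungs; 0 open at p ≤ 13 (kit j285126).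
MODEL/structure-side valuation bookkeeping of the cell's own rationals; nothing about ζ(5); no γ; records in print UNMOVED.
-/

open Finset

namespace Summit.KontsevichZagierPeriods.Zeta5Search.FullProfile

open Summit.KontsevichZagierPeriods.Zeta5Search.ClusterValuation
open Summit.KontsevichZagierPeriods.Zeta5Search.CasoratianValuation (InPolytope shift casoratian pairFloors refund)
open Summit.KontsevichZagierPeriods.Zeta5Search.WedgeDictionary (dOf)
open Summit.KontsevichZagierPeriods.Zeta5Search.ClassTypeCover
open Summit.KontsevichZagierPeriods.Zeta5Search.DenomLaw (cStar FirstPeriod Sorted7 zeroClasses_of_cover zeroBound_of_classes zeroPointBound_of_classes cover_A3K)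
open Summit.KontsevichZagierPeriods.Zeta5Search.DenomLaw.FirstPeriodKit (cStar_le_eleven sorted7_chain firstPeriod_pair pairFloors_expand)
open Summit.KontsevichZagierPeriods.Zeta5Search.ZeroWindows (ZeroWindowClasses)
open Summit.KontsevichZagierPeriods.Zeta5Search.TopFamFP (cover_J_j)
open Summit.KontsevichZagierPeriods.Zeta5Search.StairFLAG (cover_B_j)
open Summit.KontsevichZagierPeriods.Zeta5Search.SortedProfile

/-! ## The `N_p = 13` profile with short blocks `(1,2),…,(1,7),(2,3),(2,4)` -/

section P13C

variable {b : ℕ → ℤ} {j p : ℕ}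

/-- On this profile `p < d(b) < 3p` (from three long pair blocks, resp. the short blocks, the sorted chain and `p ≤ b₇ ≤ b₁ < 2p`). -/
theorem d_bounds13c (hs : Sorted7 b) (hP : (p : ℤ) ≤ b 7) (hQ : b 0 < (p : ℤ) + b 1 + b 7) (hQ24 : b 0 < (p : ℤ) + b 2 + b 4) (hQ25 : (p : ℤ) + b 2 + b 5 ≤ b 0) (hQ34 : (p : ℤ) + b 3 + b 4 ≤ b 0) (hF1 : b 1 < 2 * (p : ℤ)) :
    (p : ℤ) < dOf b ∧ dOf b < 3 * (p : ℤ) := by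
  obtain ⟨h21, h32, h43, h54, h65, h76⟩ := sorted7_chain hs
  rw [DecompositionWholeCone.dOf_expand]; constructor <;> linarith

/-- **`N_p = 13`** on this profile: the pair digits of the eight short blocks are `0`, the other thirteen are `1`. -/
theorem pairFloors_eq_13c (hb : InPolytope b) (hs : Sorted7 b) (hp : 0 < p) (hQ : b 0 < (p : ℤ) + b 1 + b 7) (hQ24 : b 0 < (p : ℤ) + b 2 + b 4) (hQ25 : (p : ℤ) + b 2 + b 5 ≤ b 0) (hQ34 : (p : ℤ) + b 3 + b 4 ≤ b 0) (hfp : FirstPeriod b p) : pairFloors b p = 13 := by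
  obtain ⟨h21, h32, h43, h54, h65, h76⟩ := sorted7_chain hs
  obtain ⟨h0, hb1, hb2, hb3, hb4, hb5, hb6, hb7, hc1⟩ := box hb
  have hp0 : (0 : ℤ) < p := by exact_mod_cast hp
  have one : ∀ z : ℤ, (p : ℤ) ≤ z → z ≤ 2 * (p : ℤ) - 1 → z / (p : ℤ) = 1 := fun z h1 h2 => by
    rw [Int.ediv_eq_iff_of_pos hp0]; constructor <;> linarith
  have z12 : (b 0 - b 1 - b 2) / (p : ℤ) = 0 := Int.ediv_eq_zero_of_lt (by linarith) (by linarith)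
  have z13 : (b 0 - b 1 - b 3) / (p : ℤ) = 0 := Int.ediv_eq_zero_of_lt (by linarith) (by linarith)
  have z14 : (b 0 - b 1 - b 4) / (p : ℤ) = 0 := Int.ediv_eq_zero_of_lt (by linarith) (by linarith)
  have z15 : (b 0 - b 1 - b 5) / (p : ℤ) = 0 := Int.ediv_eq_zero_of_lt (by linarith) (by linarith)
  have z16 : (b 0 - b 1 - b 6) / (p : ℤ) = 0 := Int.ediv_eq_zero_of_lt (by linarith) (by linarith)
  have z17 : (b 0 - b 1 - b 7) / (p : ℤ) = 0 := Int.ediv_eq_zero_of_lt (by linarith) (by linarith)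
  have z23 : (b 0 - b 2 - b 3) / (p : ℤ) = 0 := Int.ediv_eq_zero_of_lt (by linarith) (by linarith)
  have z24 : (b 0 - b 2 - b 4) / (p : ℤ) = 0 := Int.ediv_eq_zero_of_lt (by linarith) (by linarith)
  have U := fun (i k : ℕ) (hi : i < 7) (hk : k < 7) (hik : i < k) => firstPeriod_pair hfp hi hk hik
  rw [pairFloors_expand, z12, z13, z14, z15, z16, z17, z23, z24,
    one _ (by linarith) (U 1 4 (by norm_num) (by norm_num) (by norm_num)),
    one _ (by linarith) (U 1 5 (by norm_num) (by norm_num) (by norm_num)),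
    one _ (by linarith) (U 1 6 (by norm_num) (by norm_num) (by norm_num)),
    one _ (by linarith) (U 2 3 (by norm_num) (by norm_num) (by norm_num)),
    one _ (by linarith) (U 2 4 (by norm_num) (by norm_num) (by norm_num)),
    one _ (by linarith) (U 2 5 (by norm_num) (by norm_num) (by norm_num)),
    one _ (by linarith) (U 2 6 (by norm_num) (by norm_num) (by norm_num)),
    one _ (by linarith) (U 3 4 (by norm_num) (by norm_num) (by norm_num)),
    one _ (by linarith) (U 3 5 (by norm_num) (by norm_num) (by norm_num)),
    one _ (by linarith) (U 3 6 (by norm_num) (by norm_num) (by norm_num)),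
    one _ (by linarith) (U 4 5 (by norm_num) (by norm_num) (by norm_num)),
    one _ (by linarith) (U 4 6 (by norm_num) (by norm_num) (by norm_num)),
    one _ (by linarith) (U 5 6 (by norm_num) (by norm_num) (by norm_num))]
  norm_num

/-- **THEOREM LB / the double-drop bonus on this profile, general `b`**: `v_p(Cas_j(b)) ≥ −7` — where a class of type `[1,−4,−4,1]` (exponent `−6`)
exists, the double drop at `N = 6` gives `casLB + 2 = −9 + 2`; where none exists, THEOREM LB alone gives `−5 − 2 = −7` (`FlagRayDominance.cover_B_j`). -/
theorem cas_ge13c_neg7 (hb : InPolytope b) (hs : Sorted7 b) (hbj : InPolytope (shift b j)) (hj1 : 1 ≤ j) (hj7 : j ≤ 7)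
    (hprime : p.Prime) (hp5 : 5 ≤ p) (hwin : (b 0 + 2 : ℤ) < (p : ℤ) ^ 2) (hP : (p : ℤ) ≤ b 7) (hQ : b 0 < (p : ℤ) + b 1 + b 7) (hQ24 : b 0 < (p : ℤ) + b 2 + b 4) (hQ25 : (p : ℤ) + b 2 + b 5 ≤ b 0) (hQ34 : (p : ℤ) + b 3 + b 4 ≤ b 0)
    (hF1 : b 1 < 2 * (p : ℤ)) (hF2 : b 0 < 2 * (p : ℤ) + b 6 + b 7) (hcas : casoratian b j ≠ 0) : (-7 : ℤ) ≤ padicValRat p (casoratian b j) := by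
  haveI : Fact p.Prime := ⟨hprime⟩
  have hp2 : p % 2 = 1 := Nat.odd_iff.1 (hprime.odd_of_ne_two (by omega))
  obtain ⟨h21, h32, h43, h54, h65, h76⟩ := sorted7_chain hs
  obtain ⟨h0, hb1, hb2, hb3, hb4, hb5, hb6, hb7, hc1⟩ := box hb
  have hpd : (p : ℤ) ≤ dOf b := by rw [DecompositionWholeCone.dOf_expand]; linarith
  have hpb : (p : ℤ) ≤ b 0 := by linarith
  rcases Int.emod_two_eq_zero_or_one (b 0) with hr | hr
  · exact cover_B_j hb hj1 hj7 hbj hprime hp5 hpb hpd hwin (cover13c_ev hb hs hP hQ hQ24 hQ25 hQ34 hF1 hF2 hp5 hp2 hr) (N := 6) (by norm_num) (by decide)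
      (B := -3) (A' := -5) (B' := -2) (c := -7) (by rw [oddFlag_false hr]; decide) (by norm_num) (by rw [oddFlag_false hr]; decide)
      (by rw [oddFlag_false hr]; decide) (by norm_num) (by norm_num) (by norm_num) (by norm_num) hcas
  · exact cover_B_j hb hj1 hj7 hbj hprime hp5 hpb hpd hwin (cover13c_od hb hs hP hQ hQ24 hQ25 hQ34 hF1 hF2 hp5 hp2 hr) (N := 6) (by norm_num) (by decide)
      (B := -3) (A' := -5) (B' := -2) (c := -7) (by rw [oddFlag_true hr]; decide) (by norm_num) (by rw [oddFlag_true hr]; decide)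
      (by rw [oddFlag_true hr]; decide) (by norm_num) (by norm_num) (by norm_num) (by norm_num) hcas

/-- **The ZERO type-space law on this profile at `2p ≤ d`, general `b`**: `v_p(Cas_j(b)) ≥ −6 = 6 − 2M` at `M = 6` (zero-point structure `(6; [[1, -4, -4, 1]], [[1, -5, -2, 1]])`,
at most two orbit points; degree condition `4p ≤ 2d + 1`). -/
theorem cas_ge13c_neg6 (hb : InPolytope b) (hs : Sorted7 b) (hbj : InPolytope (shift b j)) (hj1 : 1 ≤ j) (hj7 : j ≤ 7)
    (hprime : p.Prime) (hp5 : 5 ≤ p) (hwin : (b 0 + 2 : ℤ) < (p : ℤ) ^ 2) (hP : (p : ℤ) ≤ b 7) (hQ : b 0 < (p : ℤ) + b 1 + b 7) (hQ24 : b 0 < (p : ℤ) + b 2 + b 4) (hQ25 : (p : ℤ) + b 2 + b 5 ≤ b 0) (hQ34 : (p : ℤ) + b 3 + b 4 ≤ b 0)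
    (hF1 : b 1 < 2 * (p : ℤ)) (hF2 : b 0 < 2 * (p : ℤ) + b 6 + b 7) (hd : 2 * (p : ℤ) ≤ dOf b) (hcas : casoratian b j ≠ 0) : (-6 : ℤ) ≤ padicValRat p (casoratian b j) := by
  haveI : Fact p.Prime := ⟨hprime⟩
  have hp2 : p % 2 = 1 := Nat.odd_iff.1 (hprime.odd_of_ne_two (by omega))
  obtain ⟨h21, h32, h43, h54, h65, h76⟩ := sorted7_chain hs
  obtain ⟨h0, hb1, hb2, hb3, hb4, hb5, hb6, hb7, hc1⟩ := box hb
  have hpb : (p : ℤ) ≤ b 0 := by linarith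
  have hdeg : (p : ℤ) * (((6 : ℕ) : ℤ) - 2) ≤ 2 * dOf b + 1 := by push_cast; linarith
  have hD : ∀ T ∈ ([[1, -4, -4, 1]] : List (List ℤ)), T.reverse = T := (by decide)
  have hC : ZeroWindowClasses b p 6 [[1, -4, -4, 1]] [[1, -5, -2, 1]] := by
    rcases Int.emod_two_eq_zero_or_one (b 0) with hr | hr
    · exact zeroClasses_of_cover h0 (cover13c_ev hb hs hP hQ hQ24 hQ25 hQ34 hF1 hF2 hp5 hp2 hr) (by rw [oddFlag_false hr]; decide)
    · exact zeroClasses_of_cover h0 (cover13c_od hb hs hP hQ hQ24 hQ25 hQ34 hF1 hF2 hp5 hp2 hr) (by rw [oddFlag_true hr]; decide)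
  have h := zeroBound_of_classes hb hbj hj1 hj7 hprime hp5 hpb hwin (M := 6) (by norm_num) (by decide) hD (by decide) hC hdeg hcas
  simpa using h

/-- **`PathAccountingFirstPeriod`'s conclusion on this `N_p = 13` profile (short blocks `(1,2),…,(1,7),(2,3),(2,4)`), EVERY sorted `b`, every direction `j`, every depth**
(`C⋆ ≤ 10`; node `⌊d/p⌋ − 13 + 6`: `-7` at `⌊d/p⌋ = 1`, `-6` at `⌊d/p⌋ = 2`; `p < d < 3p`). -/
theorem pathAccounting_profile13c (b : ℕ → ℤ) (j p : ℕ) (hb : InPolytope b) (hs : Sorted7 b) (hbj : InPolytope (shift b j))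
    (hj1 : 1 ≤ j) (hj7 : j ≤ 7) (hprime : p.Prime) (hp5 : 5 ≤ p) (hwin : (b 0 + 2 : ℤ) < (p : ℤ) ^ 2) (hfp : FirstPeriod b p)
    (hP : (p : ℤ) ≤ b 7) (hQ : b 0 < (p : ℤ) + b 1 + b 7) (hQ24 : b 0 < (p : ℤ) + b 2 + b 4) (hQ25 : (p : ℤ) + b 2 + b 5 ≤ b 0) (hQ34 : (p : ℤ) + b 3 + b 4 ≤ b 0)
    (hcas : casoratian b j ≠ 0) :
    dOf b / (p : ℤ) - pairFloors b p - min (if 2 ≤ dOf b / (p : ℤ) then (1 : ℤ) else 0) (5 - (cStar b p : ℤ))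
      ≤ padicValRat p (casoratian b j) := by
  obtain ⟨hF1, hF2⟩ := fp_bounds hfp
  have hp0 : (0 : ℤ) < p := by exact_mod_cast hprime.pos
  rw [pairFloors_eq_13c hb hs hprime.pos hQ hQ24 hQ25 hQ34 hfp]
  have hC10 : (cStar b p : ℤ) ≤ 10 := by exact_mod_cast cStar_le_ten_15a hs hQ
  obtain ⟨-, hd3⟩ := d_bounds13c hs hP hQ hQ24 hQ25 hQ34 hF1
  have hfd3 : dOf b / (p : ℤ) < 3 := by rw [Int.ediv_lt_iff_lt_mul hp0]; linarith
  by_cases h2 : 2 * (p : ℤ) ≤ dOf b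
  · have hfd : 2 ≤ dOf b / (p : ℤ) := by rw [Int.le_ediv_iff_mul_le hp0]; linarith
    rw [if_pos hfd]
    have hmin' : -5 ≤ min (1 : ℤ) (5 - (cStar b p : ℤ)) := le_min (by norm_num) (by linarith)
    linarith [cas_ge13c_neg6 hb hs hbj hj1 hj7 hprime hp5 hwin hP hQ hQ24 hQ25 hQ34 hF1 hF2 h2 hcas]
  · push Not at h2
    have hfd : dOf b / (p : ℤ) < 2 := by rw [Int.ediv_lt_iff_lt_mul hp0]; linarith
    have hmin : -5 ≤ min (if 2 ≤ dOf b / (p : ℤ) then (1 : ℤ) else 0) (5 - (cStar b p : ℤ)) :=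
      le_min (by split_ifs <;> norm_num) (by linarith)
    linarith [cas_ge13c_neg7 hb hs hbj hj1 hj7 hprime hp5 hwin hP hQ hQ24 hQ25 hQ34 hF1 hF2 hcas]

/-- **THE NODE ON THIS `N_p = 13` PROFILE, EVERY SORTED `b`, EVERY DEPTH: `PathAccountingFirstPeriod` with its binders VERBATIM plus `p ≤ b₇` and the profile
inequalities.** -/
theorem pathAccountingFirstPeriod_profile13c :
    ∀ (b : ℕ → ℤ) (p : ℕ), InPolytope b → Sorted7 b → InPolytope (shift b 7) →
      p.Prime → 5 ≤ p → (b 0 + 2 : ℤ) < (p : ℤ) ^ 2 → FirstPeriod b p →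
      (p : ℤ) ≤ b 7 → b 0 < (p : ℤ) + b 1 + b 7 → b 0 < (p : ℤ) + b 2 + b 4 → (p : ℤ) + b 2 + b 5 ≤ b 0 → (p : ℤ) + b 3 + b 4 ≤ b 0 → casoratian b 7 ≠ 0 →
        dOf b / (p : ℤ) - pairFloors b p - min (if 2 ≤ dOf b / (p : ℤ) then (1 : ℤ) else 0) (5 - (cStar b p : ℤ))
          ≤ padicValRat p (casoratian b 7) :=
  fun b p hb hs hb7 hprime hp5 hwin hfp hP hQ hQ24 hQ25 hQ34 hcas =>
    pathAccounting_profile13c b 7 p hb hs hb7 (by norm_num) (by norm_num) hprime hp5 hwin hfp hP hQ hQ24 hQ25 hQ34 hcas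

end P13C

/-! ## The `N_p = 13` profile with short blocks `(1,2),…,(1,6),(2,3),(2,4),(2,5)` -/

section P13D

variable {b : ℕ → ℤ} {j p : ℕ}

/-- On this profile `p < d(b) < 3p` (from three long pair blocks, resp. the short blocks, the sorted chain and `p ≤ b₇ ≤ b₁ < 2p`). -/
theorem d_bounds13d (hs : Sorted7 b) (hP : (p : ℤ) ≤ b 7) (hQ : b 0 < (p : ℤ) + b 1 + b 6) (hQ25 : b 0 < (p : ℤ) + b 2 + b 5) (hQ7 : (p : ℤ) + b 1 + b 7 ≤ b 0) (hQ26 : (p : ℤ) + b 2 + b 6 ≤ b 0) (hQ34 : (p : ℤ) + b 3 + b 4 ≤ b 0) (hF1 : b 1 < 2 * (p : ℤ)) :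
    (p : ℤ) < dOf b ∧ dOf b < 3 * (p : ℤ) := by
  obtain ⟨h21, h32, h43, h54, h65, h76⟩ := sorted7_chain hs
  rw [DecompositionWholeCone.dOf_expand]; constructor <;> linarith

/-- **`N_p = 13`** on this profile: the pair digits of the eight short blocks are `0`, the other thirteen are `1`. -/
theorem pairFloors_eq_13d (hb : InPolytope b) (hs : Sorted7 b) (hp : 0 < p) (hQ : b 0 < (p : ℤ) + b 1 + b 6) (hQ25 : b 0 < (p : ℤ) + b 2 + b 5) (hQ7 : (p : ℤ) + b 1 + b 7 ≤ b 0) (hQ26 : (p : ℤ) + b 2 + b 6 ≤ b 0) (hQ34 : (p : ℤ) + b 3 + b 4 ≤ b 0) (hfp : FirstPeriod b p) : pairFloors b p = 13 := by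
  obtain ⟨h21, h32, h43, h54, h65, h76⟩ := sorted7_chain hs
  obtain ⟨h0, hb1, hb2, hb3, hb4, hb5, hb6, hb7, hc1⟩ := box hb
  have hp0 : (0 : ℤ) < p := by exact_mod_cast hp
  have one : ∀ z : ℤ, (p : ℤ) ≤ z → z ≤ 2 * (p : ℤ) - 1 → z / (p : ℤ) = 1 := fun z h1 h2 => by
    rw [Int.ediv_eq_iff_of_pos hp0]; constructor <;> linarith
  have z12 : (b 0 - b 1 - b 2) / (p : ℤ) = 0 := Int.ediv_eq_zero_of_lt (by linarith) (by linarith)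
  have z13 : (b 0 - b 1 - b 3) / (p : ℤ) = 0 := Int.ediv_eq_zero_of_lt (by linarith) (by linarith)
  have z14 : (b 0 - b 1 - b 4) / (p : ℤ) = 0 := Int.ediv_eq_zero_of_lt (by linarith) (by linarith)
  have z15 : (b 0 - b 1 - b 5) / (p : ℤ) = 0 := Int.ediv_eq_zero_of_lt (by linarith) (by linarith)
  have z16 : (b 0 - b 1 - b 6) / (p : ℤ) = 0 := Int.ediv_eq_zero_of_lt (by linarith) (by linarith)
  have z23 : (b 0 - b 2 - b 3) / (p : ℤ) = 0 := Int.ediv_eq_zero_of_lt (by linarith) (by linarith)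
  have z24 : (b 0 - b 2 - b 4) / (p : ℤ) = 0 := Int.ediv_eq_zero_of_lt (by linarith) (by linarith)
  have z25 : (b 0 - b 2 - b 5) / (p : ℤ) = 0 := Int.ediv_eq_zero_of_lt (by linarith) (by linarith)
  have U := fun (i k : ℕ) (hi : i < 7) (hk : k < 7) (hik : i < k) => firstPeriod_pair hfp hi hk hik
  rw [pairFloors_expand, z12, z13, z14, z15, z16, z23, z24, z25,
    one _ (by linarith) (U 0 6 (by norm_num) (by norm_num) (by norm_num)),
    one _ (by linarith) (U 1 5 (by norm_num) (by norm_num) (by norm_num)),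
    one _ (by linarith) (U 1 6 (by norm_num) (by norm_num) (by norm_num)),
    one _ (by linarith) (U 2 3 (by norm_num) (by norm_num) (by norm_num)),
    one _ (by linarith) (U 2 4 (by norm_num) (by norm_num) (by norm_num)),
    one _ (by linarith) (U 2 5 (by norm_num) (by norm_num) (by norm_num)),
    one _ (by linarith) (U 2 6 (by norm_num) (by norm_num) (by norm_num)),
    one _ (by linarith) (U 3 4 (by norm_num) (by norm_num) (by norm_num)),
    one _ (by linarith) (U 3 5 (by norm_num) (by norm_num) (by norm_num)),
    one _ (by linarith) (U 3 6 (by norm_num) (by norm_num) (by norm_num)),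
    one _ (by linarith) (U 4 5 (by norm_num) (by norm_num) (by norm_num)),
    one _ (by linarith) (U 4 6 (by norm_num) (by norm_num) (by norm_num)),
    one _ (by linarith) (U 5 6 (by norm_num) (by norm_num) (by norm_num))]
  norm_num

/-- **THEOREM A‴ (𝒦-form, `p ≤ d`) on this profile, general `b`**: `v_p(Cas_j(b)) ≥ −6 = 6 − 2M` in the frame `(6, [1,−4,−4,1])` (gen 19's `DenomLaw.cover_A3K`;
the four A‴ clauses hold on both covers, the deep palindrome being virtual where only its raises `[1,−4,−3,1]` / `[1,−3,−4,1]` occur). -/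
theorem cas_ge13d_neg6 (hb : InPolytope b) (hs : Sorted7 b) (hbj : InPolytope (shift b j)) (hj1 : 1 ≤ j) (hj7 : j ≤ 7)
    (hprime : p.Prime) (hp5 : 5 ≤ p) (hwin : (b 0 + 2 : ℤ) < (p : ℤ) ^ 2) (hP : (p : ℤ) ≤ b 7) (hQ : b 0 < (p : ℤ) + b 1 + b 6) (hQ25 : b 0 < (p : ℤ) + b 2 + b 5) (hQ7 : (p : ℤ) + b 1 + b 7 ≤ b 0) (hQ26 : (p : ℤ) + b 2 + b 6 ≤ b 0) (hQ34 : (p : ℤ) + b 3 + b 4 ≤ b 0)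
    (hF1 : b 1 < 2 * (p : ℤ)) (hF2 : b 0 < 2 * (p : ℤ) + b 6 + b 7) (hcas : casoratian b j ≠ 0) : (-6 : ℤ) ≤ padicValRat p (casoratian b j) := by
  haveI : Fact p.Prime := ⟨hprime⟩
  have hp2 : p % 2 = 1 := Nat.odd_iff.1 (hprime.odd_of_ne_two (by omega))
  obtain ⟨h21, h32, h43, h54, h65, h76⟩ := sorted7_chain hs
  obtain ⟨h0, hb1, hb2, hb3, hb4, hb5, hb6, hb7, hc1⟩ := box hb
  have hpd : (p : ℤ) ≤ dOf b := by rw [DecompositionWholeCone.dOf_expand]; linarith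
  have hpb : (p : ℤ) ≤ b 0 := by linarith
  have hT : ([1, -4, -4, 1] : List ℤ).reverse = [1, -4, -4, 1] := by decide
  rcases Int.emod_two_eq_zero_or_one (b 0) with hr | hr
  · exact cover_A3K hb hbj hj1 hj7 hprime hp5 hpb hwin hpd (cover13d_ev hb hs hP hQ hQ25 hQ7 hQ26 hQ34 hF1 hF2 hp5 hp2 hr) (M := 6) (by norm_num) (by decide) hT
      (by rw [oddFlag_false hr]; decide) (by norm_num) hcas
  · exact cover_A3K hb hbj hj1 hj7 hprime hp5 hpb hwin hpd (cover13d_od hb hs hP hQ hQ25 hQ7 hQ26 hQ34 hF1 hF2 hp5 hp2 hr) (M := 6) (by norm_num) (by decide) hT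
      (by rw [oddFlag_true hr]; decide) (by norm_num) hcas

/-- **The ZERO-POINT type-space law on this profile at `2p ≤ d`, general `b`**: `v_p(Cas_j(b)) ≥ −5 = 7 − 2M` at `M = 6` (one-point structure
`(6; [[1, -4, -4, 1]], [])`; degree condition `4p ≤ 2d + 1`; `DenomLaw.zeroPointBound_of_classes`). -/
theorem cas_ge13d_neg5 (hb : InPolytope b) (hs : Sorted7 b) (hbj : InPolytope (shift b j)) (hj1 : 1 ≤ j) (hj7 : j ≤ 7)
    (hprime : p.Prime) (hp5 : 5 ≤ p) (hwin : (b 0 + 2 : ℤ) < (p : ℤ) ^ 2) (hP : (p : ℤ) ≤ b 7) (hQ : b 0 < (p : ℤ) + b 1 + b 6) (hQ25 : b 0 < (p : ℤ) + b 2 + b 5) (hQ7 : (p : ℤ) + b 1 + b 7 ≤ b 0) (hQ26 : (p : ℤ) + b 2 + b 6 ≤ b 0) (hQ34 : (p : ℤ) + b 3 + b 4 ≤ b 0)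
    (hF1 : b 1 < 2 * (p : ℤ)) (hF2 : b 0 < 2 * (p : ℤ) + b 6 + b 7) (hd : 2 * (p : ℤ) ≤ dOf b) (hcas : casoratian b j ≠ 0) : (-5 : ℤ) ≤ padicValRat p (casoratian b j) := by
  haveI : Fact p.Prime := ⟨hprime⟩
  have hp2 : p % 2 = 1 := Nat.odd_iff.1 (hprime.odd_of_ne_two (by omega))
  obtain ⟨h21, h32, h43, h54, h65, h76⟩ := sorted7_chain hs
  obtain ⟨h0, hb1, hb2, hb3, hb4, hb5, hb6, hb7, hc1⟩ := box hb
  have hpb : (p : ℤ) ≤ b 0 := by linarith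
  have hdeg : (p : ℤ) * (((6 : ℕ) : ℤ) - 2) ≤ 2 * dOf b + 1 := by push_cast; linarith
  have hD : ∀ T ∈ ([[1, -4, -4, 1]] : List (List ℤ)), T.reverse = T := (by decide)
  have hC : ZeroWindowClasses b p 6 [[1, -4, -4, 1]] [] := by
    rcases Int.emod_two_eq_zero_or_one (b 0) with hr | hr
    · exact zeroClasses_of_cover h0 (cover13d_ev hb hs hP hQ hQ25 hQ7 hQ26 hQ34 hF1 hF2 hp5 hp2 hr) (by rw [oddFlag_false hr]; decide)
    · exact zeroClasses_of_cover h0 (cover13d_od hb hs hP hQ hQ25 hQ7 hQ26 hQ34 hF1 hF2 hp5 hp2 hr) (by rw [oddFlag_true hr]; decide)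
  have h := zeroPointBound_of_classes hb hbj hj1 hj7 hprime hp5 hpb hwin (M := 6) (by norm_num) (by decide) hD (by decide) hC hdeg hcas
  simpa using h

/-- **`PathAccountingFirstPeriod`'s conclusion on this `N_p = 13` profile (short blocks `(1,2),…,(1,6),(2,3),(2,4),(2,5)`), EVERY sorted `b`, every direction `j`, every depth**
(`C⋆ ≤ 11`; node `⌊d/p⌋ − 13 + 5`: `-6` at `⌊d/p⌋ = 1`, `-5` at `⌊d/p⌋ = 2`; `p < d < 3p`). -/
theorem pathAccounting_profile13d (b : ℕ → ℤ) (j p : ℕ) (hb : InPolytope b) (hs : Sorted7 b) (hbj : InPolytope (shift b j))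
    (hj1 : 1 ≤ j) (hj7 : j ≤ 7) (hprime : p.Prime) (hp5 : 5 ≤ p) (hwin : (b 0 + 2 : ℤ) < (p : ℤ) ^ 2) (hfp : FirstPeriod b p)
    (hP : (p : ℤ) ≤ b 7) (hQ : b 0 < (p : ℤ) + b 1 + b 6) (hQ25 : b 0 < (p : ℤ) + b 2 + b 5) (hQ7 : (p : ℤ) + b 1 + b 7 ≤ b 0) (hQ26 : (p : ℤ) + b 2 + b 6 ≤ b 0) (hQ34 : (p : ℤ) + b 3 + b 4 ≤ b 0)
    (hcas : casoratian b j ≠ 0) :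
    dOf b / (p : ℤ) - pairFloors b p - min (if 2 ≤ dOf b / (p : ℤ) then (1 : ℤ) else 0) (5 - (cStar b p : ℤ))
      ≤ padicValRat p (casoratian b j) := by
  obtain ⟨hF1, hF2⟩ := fp_bounds hfp
  have hp0 : (0 : ℤ) < p := by exact_mod_cast hprime.pos
  rw [pairFloors_eq_13d hb hs hprime.pos hQ hQ25 hQ7 hQ26 hQ34 hfp]
  have hC11 : (cStar b p : ℤ) ≤ 11 := by exact_mod_cast cStar_le_eleven b p
  obtain ⟨-, hd3⟩ := d_bounds13d hs hP hQ hQ25 hQ7 hQ26 hQ34 hF1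
  have hfd3 : dOf b / (p : ℤ) < 3 := by rw [Int.ediv_lt_iff_lt_mul hp0]; linarith
  by_cases h2 : 2 * (p : ℤ) ≤ dOf b
  · have hfd : 2 ≤ dOf b / (p : ℤ) := by rw [Int.le_ediv_iff_mul_le hp0]; linarith
    rw [if_pos hfd]
    have hmin' : -6 ≤ min (1 : ℤ) (5 - (cStar b p : ℤ)) := le_min (by norm_num) (by linarith)
    linarith [cas_ge13d_neg5 hb hs hbj hj1 hj7 hprime hp5 hwin hP hQ hQ25 hQ7 hQ26 hQ34 hF1 hF2 h2 hcas]
  · push Not at h2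
    have hfd : dOf b / (p : ℤ) < 2 := by rw [Int.ediv_lt_iff_lt_mul hp0]; linarith
    have hmin : -6 ≤ min (if 2 ≤ dOf b / (p : ℤ) then (1 : ℤ) else 0) (5 - (cStar b p : ℤ)) :=
      le_min (by split_ifs <;> norm_num) (by linarith)
    linarith [cas_ge13d_neg6 hb hs hbj hj1 hj7 hprime hp5 hwin hP hQ hQ25 hQ7 hQ26 hQ34 hF1 hF2 hcas]

/-- **THE NODE ON THIS `N_p = 13` PROFILE, EVERY SORTED `b`, EVERY DEPTH: `PathAccountingFirstPeriod` with its binders VERBATIM plus `p ≤ b₇` and the profile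
inequalities.** -/
theorem pathAccountingFirstPeriod_profile13d :
    ∀ (b : ℕ → ℤ) (p : ℕ), InPolytope b → Sorted7 b → InPolytope (shift b 7) →
      p.Prime → 5 ≤ p → (b 0 + 2 : ℤ) < (p : ℤ) ^ 2 → FirstPeriod b p →
      (p : ℤ) ≤ b 7 → b 0 < (p : ℤ) + b 1 + b 6 → b 0 < (p : ℤ) + b 2 + b 5 → (p : ℤ) + b 1 + b 7 ≤ b 0 → (p : ℤ) + b 2 + b 6 ≤ b 0 → (p : ℤ) + b 3 + b 4 ≤ b 0 → casoratian b 7 ≠ 0 →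
        dOf b / (p : ℤ) - pairFloors b p - min (if 2 ≤ dOf b / (p : ℤ) then (1 : ℤ) else 0) (5 - (cStar b p : ℤ))
          ≤ padicValRat p (casoratian b 7) :=
  fun b p hb hs hb7 hprime hp5 hwin hfp hP hQ hQ25 hQ7 hQ26 hQ34 hcas =>
    pathAccounting_profile13d b 7 p hb hs hb7 (by norm_num) (by norm_num) hprime hp5 hwin hfp hP hQ hQ25 hQ7 hQ26 hQ34 hcas

end P13D

end Summit.KontsevichZagierPeriods.Zeta5Search.FullProfile
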